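import Summits.QuantumFields.YangMills.Theorems.UnitScaleTiltProp7CentrePinnedHessianPoincareCovFramesRoot
import Summits.QuantumFields.YangMills.Theorems.UnitScaleTiltProp7SmallFieldThm311
import Summits.QuantumFields.YangMills.Theorems.UnitScaleTiltProp7B8Prop7DivAlg
import HarnessLib

/-!
# Route `UnitScaleTilt`, crux K1 «MinimiserStabilityRegPr» (stmt-QuantumFields-19200), route-R E′ path (α′), S2 = P-cov2 ∕ (E1-b) covariant, brick (D1-cov) at the member — THE
# PLAQUETTE DATUM DISCHARGED TOO: `hplaq` of ✓ `Prop7CentrePinnedHessianPoincareCov.sum_hs_le_covLaplace_hs` from `RegPr` with `a := α₀·L^{−2(K−n)}` (the (6)(e) clause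
# `|W(∂p) − 1| < α₀η²`), so that (D1-cov) at the member displays ONLY the pinning `he0` and the ℓ_k-free smallness window in `α₀`

Cell `ym3-torus`, width seat `ym3-torus-px4` (gen 3); third file of the row «(D1-cov)-FRAMES» (★routeR-w3 g6 GO 2026-08-28T21:47:43Z) after ✓ `…CovFrames` (p671512: `hframes`
discharged) and ✓ `…CovFramesRoot` (p671794: root form).  THEOREMS ONLY (0 `def`, 0 `sorry`); `--supports stmt-QuantumFields-19200`, count-neutral.  YM₃ on T³ is a ladder
rung (R3), not the Clay problem; nothing here claims a stub, the crux, d = 4 or the mass gap.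

WHAT IS PROVED (ns `…Theorems.Prop7CentrePinnedHessianPoincareCovMember`; the member `PV 2 ℓ m K`, `k = K − n`, `U = unitsField (toUField W)`, SU(2)).
* `norm_plaqU_sub_one_le_of_plaqSmall` — the (6)(e) datum in `plaqU` letters: `PlaqSmall a W` (`0 < a`) ⇒ `‖plaqU (torusT (F.P K) 0) (unitsField (toUField W)) μ ν x − 1‖ ≤ a` for ALL
  index pairs (✓ `Prop7CovariantCoercivity.plaqU_eq_holT` of `…Prop7SmallFieldThm311` + ✓ `Prop7B8Prop7DivAlg.norm_coe_holT_plaqWord_sub_one_lt` + ✓ `val_holT_unitsField` ∕ `holT_toUField` ∕ `val_suIncl`).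
* `norm_plaqU_sub_one_le_of_regPr` — the same from `RegPr F n K α₀ W` with `a := regThreshold F n K α₀ = α₀·(L⁻¹)^{2(K−n)}`.
* ★★★ `sum_hs_le_covLaplace_hs_of_regPr'` and ★★ `sqrt_sum_hs_le_of_regPr'` — ✓ `sum_hs_le_covLaplace_hs_of_regPr` ∕ ✓ `sqrt_sum_hs_le_of_regPr` with `hplaq` DISCHARGED at
  `a := α₀·((ℓ+1)⁻¹)^{2(K−n)}`: for `W ∈ RegPr` (`M·α₀ ≤ a₅`) and `e` (resp. every `v`) vanishing on the `(K−n)`-centres, under the window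
  `κ₁ℓ_k⁴·d²(4N(α₀L^{−2(K−n)})² + (2τ₂ + 4τ₁²)²) ≤ 1∕4` (every term `ℓ_k`-FREE: `ℓ_k⁴a² = α₀²`, `ℓ_k⁴τ₂² ≍ (c35Mα₀)²`, `ℓ_k⁴τ₁⁴ ≍ (c35Mα₀)⁴` — a pure smallness condition on `α₀`),
  `Σ_x hs(e x) ≤ 2(κ₁ℓ_k⁴ + (κ₁ℓ_k⁴(2da + 8dτ₁²))²)·Σ_x hs(Δ_We x)` and its square root.  So (D1-cov) at every `RegPr` member displays ONLY `he0` and that window.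
HONEST SCOPE.  Bookkeeping; no new estimate.

References: T. Bałaban, CMP 102 (1985) 277–309 [Balaban1985Variational] ((2), (6) p.278, Prop. 7 p.299); CMP 99 (1985) 389–434 [Balaban1985BackgroundPropagators] ((3.1) p.390,
(3.35) p.396); CMP 99 (1985) 75–102 [Balaban1985RegularSpaces] ((1.33) p.82).
-/

set_option autoImplicit false

noncomputable section

open scoped Matrix.Norms.L2Operator

namespace Summit.QuantumFields.YangMills.Theorems.Prop7CentrePinnedHessianPoincareCovMember

open Literature.MathematicalPhysics.QuantumFieldTheory.Balaban1983to89
open Literature.MathematicalPhysics.QuantumFieldTheory.Balaban1983to89.T3ContinuumYM3Torus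
open Literature.MathematicalPhysics.QuantumFieldTheory.Balaban1983to89.T3PrintedRegularMinimiser (RegPr)
open Literature.MathematicalPhysics.QuantumFieldTheory.Balaban1983to89.T3RegularMinimiser (regThreshold)
open Literature.MathematicalPhysics.QuantumFieldTheory.Balaban1983to89.B6GlobalChartV1 (PV)
open B9Eq39Adjoint (covD divB plaqU)
open B9TorusCalculus (torusT)
open B7Prop1Explicit (plaqWord)
open B10Eq27TorusAxialLog (unitsField toUField holT val_holT_unitsField holT_toUField val_suIncl)
open B15DeterminingSets (embIter)
open Summit.QuantumFields.YangMills.Theorems.Prop7SectET3Members (hd3)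
open Summit.QuantumFields.YangMills.Theorems.Prop7CovariantCoercivity (plaqU_eq_holT)
open Summit.QuantumFields.YangMills.Theorems.Prop7B8Prop7DivAlg (norm_coe_holT_plaqWord_sub_one_lt)
open Summit.QuantumFields.YangMills.Theorems.Prop7CentrePinnedHessianPoincareCovFrames (sum_hs_le_covLaplace_hs_of_regPr)
open Summit.QuantumFields.YangMills.Theorems.Prop7CentrePinnedHessianPoincareCovFramesRoot (sqrt_sum_hs_le_of_regPr)

/-! ## §1 The (6)(e) plaquette datum in `plaqU` letters -/

/-- **`PlaqSmall a W` IN `plaqU` LETTERS**: for an SU(2) configuration `W` of the run-`K` torus with `|W(∂p) − 1| < a` on the positively oriented plaquettes (`0 < a`), the plaquette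
variable of the `B9Eq39Adjoint` calculus at the units background `unitsField (toUField W)` is within `a` of `1` for EVERY index pair (negative orientation = inverse holonomy, diagonal
= trivial loop). [cite: Balaban1985Variational, (2) p.278; Balaban1985BackgroundPropagators, (3.1) p.390] -/
theorem norm_plaqU_sub_one_le_of_plaqSmall (F : T3Family) (K : ℕ) {a : ℝ} (ha : 0 < a)
    {W : GaugeField (F.P K) 0 (Matrix.specialUnitaryGroup (Fin 2) ℂ)} (hW : PlaqSmall a W) (μ ν : Fin (F.P K).d) (x : Site (F.P K) 0) :
    ‖(plaqU (torusT (F.P K) 0) (fun κ z => unitsField (toUField W) ⟨z, κ⟩) μ ν x : Matrix (Fin 2) (Fin 2) ℂ) - 1‖ ≤ a := by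
  rw [plaqU_eq_holT (unitsField (toUField W)), val_holT_unitsField, holT_toUField, val_suIncl]
  exact (norm_coe_holT_plaqWord_sub_one_lt ha hW x μ ν).le

/-- **The (6)(e) datum of `RegPr` in `plaqU` letters**: `a := regThreshold F n K α₀ = α₀·(L⁻¹)^{2(K−n)}`. [cite: Balaban1985Variational, (2), (6) p.278] -/
theorem norm_plaqU_sub_one_le_of_regPr (F : T3Family) (n K : ℕ) {α₀ : ℝ} (hα₀ : 0 < α₀)
    {W : GaugeField (F.P K) 0 (Matrix.specialUnitaryGroup (Fin 2) ℂ)} (hW : RegPr F n K α₀ W) (μ ν : Fin (F.P K).d) (x : Site (F.P K) 0) :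
    ‖(plaqU (torusT (F.P K) 0) (fun κ z => unitsField (toUField W) ⟨z, κ⟩) μ ν x : Matrix (Fin 2) (Fin 2) ℂ) - 1‖ ≤ α₀ * (((F.L : ℝ))⁻¹) ^ (2 * (K - n)) := by
  have hL : (0 : ℝ) < F.L := by exact_mod_cast (lt_trans zero_lt_one F.hL.2)
  have ha : 0 < α₀ * (((F.L : ℝ))⁻¹) ^ (2 * (K - n)) := by positivity
  exact norm_plaqU_sub_one_le_of_plaqSmall F K ha hW.plaqSmall μ ν x

/-! ## §2 (D1-cov) at the member with `hframes`, `hU` AND `hplaq` discharged -/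

variable {ℓ : ℕ} {hL : Odd (ℓ + 1) ∧ 1 < ℓ + 1}

/-- ★★★ **(D1-cov) AT THE MEMBER OF RECORD, EVERYTHING BUT THE PINNING AND THE WINDOW DISCHARGED**: ✓ `sum_hs_le_covLaplace_hs_of_regPr` at `a := α₀·((ℓ+1)⁻¹)^{2(K−n)}` (the
(6)(e) clause of `RegPr`).  [cite: Giaquinta1984, Ch. III §1 Thm 1.2 pp.70–72; Balaban1985Variational, (2) p.278, Prop. 7 p.299; Balaban1985BackgroundPropagators, (3.35) p.396] -/
theorem sum_hs_le_covLaplace_hs_of_regPr' (hℓ4 : 4 ≤ ℓ) :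
    ∃ c35 a₅ : ℝ, 0 < c35 ∧ 0 < a₅ ∧
      ∀ (hℓ : 4 ≤ ℓ) (m : ℕ) (hm : 1 ≤ m) (n K a' R : ℕ) (hk1 : 1 ≤ K - n) (hsize : a' + 3 ≤ m + n) (hM8 : 8 ≤ (ℓ + 1) ^ a')
        (hR2 : 2 * (ℓ + 1) ^ 2 ≤ R) (α₀ : ℝ), 0 < α₀ → ((ℓ + 1 : ℕ) : ℝ) * (((ℓ + 1) ^ a' : ℕ) : ℝ) * α₀ ≤ a₅ →
        ∀ W : GaugeField (PV 2 ℓ m K hd3 hL) 0 (Matrix.specialUnitaryGroup (Fin 2) ℂ),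
          RegPr (⟨ℓ + 1, hL, m, hm⟩ : T3Family) n K α₀ W →
          ∀ (e : Site (PV 2 ℓ m K hd3 hL) 0 → Matrix (Fin 2) (Fin 2) ℂ), (∀ y : Site (PV 2 ℓ m K hd3 hL) (K - n), e (embIter (K - n) y) = 0) →
          (4 * 2197 * (24 * 289 * 24576 * 46116) : ℝ) * ((2 : ℕ) : ℝ) ^ 2 * ((((PV 2 ℓ m K hd3 hL).L : ℝ)) ^ (K - n)) ^ 4
              * ((((PV 2 ℓ m K hd3 hL).d : ℝ)) ^ 2 * (4 * ((2 : ℕ) : ℝ) * (α₀ * ((((PV 2 ℓ m K hd3 hL).L : ℝ))⁻¹) ^ (2 * (K - n))) ^ 2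
                + (2 * ((((ℓ + 1 : ℕ) : ℝ) ^ (K - n))⁻¹ * ((((ℓ + 1 : ℕ) : ℝ) ^ (K - n))⁻¹ * (c35 * (((ℓ + 1 : ℕ) : ℝ) * (((ℓ + 1) ^ a' : ℕ) : ℝ)) * α₀))
                    * Real.exp ((((ℓ + 1 : ℕ) : ℝ) ^ (K - n))⁻¹ * (c35 * (((ℓ + 1 : ℕ) : ℝ) * (((ℓ + 1) ^ a' : ℕ) : ℝ)) * α₀)))
                  + 4 * ((((ℓ + 1 : ℕ) : ℝ) ^ (K - n))⁻¹ * (c35 * (((ℓ + 1 : ℕ) : ℝ) * (((ℓ + 1) ^ a' : ℕ) : ℝ)) * α₀)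
                    * Real.exp ((((ℓ + 1 : ℕ) : ℝ) ^ (K - n))⁻¹ * (c35 * (((ℓ + 1 : ℕ) : ℝ) * (((ℓ + 1) ^ a' : ℕ) : ℝ)) * α₀))) ^ 2) ^ 2)) ≤ 1 / 4 →
          ∑ x : Site (PV 2 ℓ m K hd3 hL) 0, ∑ j : Fin 2, ∑ k' : Fin 2, ‖(e x) j k'‖ ^ 2
            ≤ 2 * ((4 * 2197 * (24 * 289 * 24576 * 46116) : ℝ) * ((2 : ℕ) : ℝ) ^ 2 * ((((PV 2 ℓ m K hd3 hL).L : ℝ)) ^ (K - n)) ^ 4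
                  + ((4 * 2197 * (24 * 289 * 24576 * 46116) : ℝ) * ((2 : ℕ) : ℝ) ^ 2 * ((((PV 2 ℓ m K hd3 hL).L : ℝ)) ^ (K - n)) ^ 4
                    * (2 * (PV 2 ℓ m K hd3 hL).d * (α₀ * ((((PV 2 ℓ m K hd3 hL).L : ℝ))⁻¹) ^ (2 * (K - n))) + 8 * (PV 2 ℓ m K hd3 hL).d
                      * ((((ℓ + 1 : ℕ) : ℝ) ^ (K - n))⁻¹ * (c35 * (((ℓ + 1 : ℕ) : ℝ) * (((ℓ + 1) ^ a' : ℕ) : ℝ)) * α₀)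
                        * Real.exp ((((ℓ + 1 : ℕ) : ℝ) ^ (K - n))⁻¹ * (c35 * (((ℓ + 1 : ℕ) : ℝ) * (((ℓ + 1) ^ a' : ℕ) : ℝ)) * α₀))) ^ 2)) ^ 2)
              * ∑ x : Site (PV 2 ℓ m K hd3 hL) 0, ∑ j : Fin 2, ∑ k' : Fin 2,
                  ‖(divB (torusT (PV 2 ℓ m K hd3 hL) 0) (fun κ z => unitsField (toUField W) ⟨z, κ⟩)
                      (fun κ => covD (torusT (PV 2 ℓ m K hd3 hL) 0) (fun κ z => unitsField (toUField W) ⟨z, κ⟩) κ e) x) j k'‖ ^ 2 := by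
  obtain ⟨c35, a₅, hc35, ha₅, H⟩ := sum_hs_le_covLaplace_hs_of_regPr (hL := hL) hℓ4
  refine ⟨c35, a₅, hc35, ha₅, ?_⟩
  intro hℓ m hm n K a' R hk1 hsize hM8 hR2 α₀ hα₀ hMα W hreg e he0 hwin
  exact H hℓ m hm n K a' R hk1 hsize hM8 hR2 α₀ hα₀ hMα W hreg
    (norm_plaqU_sub_one_le_of_regPr (⟨ℓ + 1, hL, m, hm⟩ : T3Family) n K hα₀ hreg) e he0 hwin

/-- ★★ **ROOT FORM, EVERYTHING BUT THE PINNING AND THE WINDOW DISCHARGED** — the `hP` row of ym-routeR-w6 g6's covariant Agmon core at the member from `RegPr` alone: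
✓ `sqrt_sum_hs_le_of_regPr` at `a := α₀·((ℓ+1)⁻¹)^{2(K−n)}`. [cite: Balaban1985Variational, (2) p.278, Prop. 7 p.299; Balaban1985BackgroundPropagators, (3.35) p.396] -/
theorem sqrt_sum_hs_le_of_regPr' (hℓ4 : 4 ≤ ℓ) :
    ∃ c35 a₅ : ℝ, 0 < c35 ∧ 0 < a₅ ∧
      ∀ (hℓ : 4 ≤ ℓ) (m : ℕ) (hm : 1 ≤ m) (n K a' R : ℕ) (hk1 : 1 ≤ K - n) (hsize : a' + 3 ≤ m + n) (hM8 : 8 ≤ (ℓ + 1) ^ a')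
        (hR2 : 2 * (ℓ + 1) ^ 2 ≤ R) (α₀ : ℝ), 0 < α₀ → ((ℓ + 1 : ℕ) : ℝ) * (((ℓ + 1) ^ a' : ℕ) : ℝ) * α₀ ≤ a₅ →
        ∀ W : GaugeField (PV 2 ℓ m K hd3 hL) 0 (Matrix.specialUnitaryGroup (Fin 2) ℂ),
          RegPr (⟨ℓ + 1, hL, m, hm⟩ : T3Family) n K α₀ W →
          (4 * 2197 * (24 * 289 * 24576 * 46116) : ℝ) * ((2 : ℕ) : ℝ) ^ 2 * ((((PV 2 ℓ m K hd3 hL).L : ℝ)) ^ (K - n)) ^ 4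
              * ((((PV 2 ℓ m K hd3 hL).d : ℝ)) ^ 2 * (4 * ((2 : ℕ) : ℝ) * (α₀ * ((((PV 2 ℓ m K hd3 hL).L : ℝ))⁻¹) ^ (2 * (K - n))) ^ 2
                + (2 * ((((ℓ + 1 : ℕ) : ℝ) ^ (K - n))⁻¹ * ((((ℓ + 1 : ℕ) : ℝ) ^ (K - n))⁻¹ * (c35 * (((ℓ + 1 : ℕ) : ℝ) * (((ℓ + 1) ^ a' : ℕ) : ℝ)) * α₀))
                    * Real.exp ((((ℓ + 1 : ℕ) : ℝ) ^ (K - n))⁻¹ * (c35 * (((ℓ + 1 : ℕ) : ℝ) * (((ℓ + 1) ^ a' : ℕ) : ℝ)) * α₀)))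
                  + 4 * ((((ℓ + 1 : ℕ) : ℝ) ^ (K - n))⁻¹ * (c35 * (((ℓ + 1 : ℕ) : ℝ) * (((ℓ + 1) ^ a' : ℕ) : ℝ)) * α₀)
                    * Real.exp ((((ℓ + 1 : ℕ) : ℝ) ^ (K - n))⁻¹ * (c35 * (((ℓ + 1 : ℕ) : ℝ) * (((ℓ + 1) ^ a' : ℕ) : ℝ)) * α₀))) ^ 2) ^ 2)) ≤ 1 / 4 →
          ∀ v : Site (PV 2 ℓ m K hd3 hL) 0 → Matrix (Fin 2) (Fin 2) ℂ, (∀ y ∈ Set.range (embIter (P := PV 2 ℓ m K hd3 hL) (K - n)), v y = 0) →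
            Real.sqrt (∑ x : Site (PV 2 ℓ m K hd3 hL) 0, ∑ j : Fin 2, ∑ k' : Fin 2, ‖(v x) j k'‖ ^ 2)
              ≤ Real.sqrt (2 * ((4 * 2197 * (24 * 289 * 24576 * 46116) : ℝ) * ((2 : ℕ) : ℝ) ^ 2 * ((((PV 2 ℓ m K hd3 hL).L : ℝ)) ^ (K - n)) ^ 4
                    + ((4 * 2197 * (24 * 289 * 24576 * 46116) : ℝ) * ((2 : ℕ) : ℝ) ^ 2 * ((((PV 2 ℓ m K hd3 hL).L : ℝ)) ^ (K - n)) ^ 4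
                      * (2 * (PV 2 ℓ m K hd3 hL).d * (α₀ * ((((PV 2 ℓ m K hd3 hL).L : ℝ))⁻¹) ^ (2 * (K - n))) + 8 * (PV 2 ℓ m K hd3 hL).d
                        * ((((ℓ + 1 : ℕ) : ℝ) ^ (K - n))⁻¹ * (c35 * (((ℓ + 1 : ℕ) : ℝ) * (((ℓ + 1) ^ a' : ℕ) : ℝ)) * α₀)
                          * Real.exp ((((ℓ + 1 : ℕ) : ℝ) ^ (K - n))⁻¹ * (c35 * (((ℓ + 1 : ℕ) : ℝ) * (((ℓ + 1) ^ a' : ℕ) : ℝ)) * α₀))) ^ 2)) ^ 2))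
                * Real.sqrt (∑ x : Site (PV 2 ℓ m K hd3 hL) 0, ∑ j : Fin 2, ∑ k' : Fin 2,
                    ‖(divB (torusT (PV 2 ℓ m K hd3 hL) 0) (fun κ z => unitsField (toUField W) ⟨z, κ⟩)
                        (fun κ => covD (torusT (PV 2 ℓ m K hd3 hL) 0) (fun κ z => unitsField (toUField W) ⟨z, κ⟩) κ v) x) j k'‖ ^ 2) := by
  obtain ⟨c35, a₅, hc35, ha₅, H⟩ := sqrt_sum_hs_le_of_regPr (hL := hL) hℓ4
  refine ⟨c35, a₅, hc35, ha₅, ?_⟩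
  intro hℓ m hm n K a' R hk1 hsize hM8 hR2 α₀ hα₀ hMα W hreg hwin v hv
  exact H hℓ m hm n K a' R hk1 hsize hM8 hR2 α₀ hα₀ hMα W hreg
    (norm_plaqU_sub_one_le_of_regPr (⟨ℓ + 1, hL, m, hm⟩ : T3Family) n K hα₀ hreg) hwin v hv

end Summit.QuantumFields.YangMills.Theorems.Prop7CentrePinnedHessianPoincareCovMember

end
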